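import Summits.Schanuel.Schanuel.Theorems.ZilberEacBranchChartClosedForm
import HarnessLib

/-!
# Arbitrary base branches, XXV: the SECOND coefficient of the phase polynomial —
# `Π_{M−1} = Φ′(0)·m′(0)^{M−1}` when the chart is `m = m′(0)·s·G(s)` with `G′(0) = 0` (`k ≥ 2`)

HONEST FRAMING.  Cell `pub-schanuel` (Zilber's Exponential-Algebraic Closedness, case ladder;
host summit Schanuel), seat 2, gen 28.  File XIV computed the top coefficient `Π_M = Φ(0)m′(0)^M`
of the phase polynomial `Π` of the witness (`r(m(s)) = Φ(s)s^{-M} − Π(1/m(s))`, `r` analytic);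
file XXIV gave the chart in closed form `m = c·s·G`, `G(0) = 1`, and for `k ≥ 2` one has
`G′(0) = 0`.  Here, one order further: **`laurentPart_coeff_pred_eq`** — under `m = c·s·G` near `0`
with `G(0) = 1`, `G′(0) = 0`, and `M = N + 1 ≥ 2`: `Π_N = Φ′(0)·c^N`.  (Proof: the polynomial limit
`(u^M Π(1/u) − Π_M)/u → Π_{M−1}` composed with `u = m(s) → 0`, against the analytic limit
`c^N·(Φ(s)G(s)^M − Φ(0))/s·G(s)^{-1} − m(s)^N r(m(s)) → c^N Φ′(0)`.)  This is the first of the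
LOWER-coefficient identities that decide the residue class `k ∣ 2M`, `Re Π_M = 0` of files XIX–XXII
generically (growth from `Re Π_{M−1} ≠ 0`); the `τ`-carrying coefficient `Π_{M−k}` is next.
Infrastructure; no density statement in this file.  EC(3,2) OPEN; NOT Schanuel's conjecture.
-/

noncomputable section

open Filter Topology Polynomial Complex

set_option linter.dupNamespace false

namespace Summit.Schanuel.Schanuel.Theorems

/-- `(u^{N+1} Π(1/u) − Π_{N+1})/u → Π_N` as `u → 0`, for `deg Π ≤ N + 1`. [folklore] -/
theorem tendsto_pow_mul_eval_inv_sub_div {Pl : ℂ[X]} {N : ℕ} (hdeg : Pl.natDegree ≤ N + 1) :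
    Tendsto (fun u : ℂ => (u ^ (N + 1) * Pl.eval u⁻¹ - Pl.coeff (N + 1)) / u) (𝓝[≠] (0 : ℂ))
      (𝓝 (Pl.coeff N)) := by
  -- `Q = Π − Π_{N+1} X^{N+1}` has degree `≤ N` and `Q_N = Π_N`
  set Q : ℂ[X] := Pl - Polynomial.C (Pl.coeff (N + 1)) * Polynomial.X ^ (N + 1) with hQ
  have hQdeg : Q.natDegree ≤ N := by
    rw [Polynomial.natDegree_le_iff_coeff_eq_zero]
    intro i hi
    rw [hQ, Polynomial.coeff_sub, Polynomial.coeff_C_mul, Polynomial.coeff_X_pow]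
    by_cases h : i = N + 1
    · subst h
      simp
    · rw [if_neg h, mul_zero, sub_zero]
      exact Polynomial.coeff_eq_zero_of_natDegree_lt (by omega)
  have hQN : Q.coeff N = Pl.coeff N := by
    rw [hQ, Polynomial.coeff_sub, Polynomial.coeff_C_mul, Polynomial.coeff_X_pow,
      if_neg (by omega), mul_zero, sub_zero]
  have h := tendsto_pow_mul_eval_inv hQdeg
  rw [hQN] at h
  refine h.congr' ?_
  filter_upwards [self_mem_nhdsWithin] with u (hu : u ≠ 0)
  rw [hQ, Polynomial.eval_sub, Polynomial.eval_mul, Polynomial.eval_C, Polynomial.eval_pow,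
    Polynomial.eval_X]
  simp only [inv_pow]
  have huN : u ^ (N + 1) ≠ 0 := pow_ne_zero _ hu
  have huN' : u ^ N ≠ 0 := pow_ne_zero _ hu
  field_simp
  ring

/-- **The second coefficient of the phase polynomial.**  Let `m = c·s·G(s)` near `0` with `G`
analytic, `G(0) = 1`, `G′(0) = 0`, `c ≠ 0` (the ramified chart for `k ≥ 2`, file XXIV), `Φ` analytic
at `0`, `Π` of degree `≤ N + 1` (`N ≥ 1`) and `r` analytic at `0` with
`r(m(s)) = Φ(s)s^{-(N+1)} − Π(1/m(s))` for small `s ≠ 0`.  Then `Π_N = Φ′(0)·c^N`. [folklore] -/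
theorem laurentPart_coeff_pred_eq {m : ℂ → ℂ} {c : ℂ} (hc0 : c ≠ 0) {G : ℂ → ℂ}
    (hGan : AnalyticAt ℂ G 0) (hG0 : G 0 = 1) (hG1 : deriv G 0 = 0)
    (hmG : ∀ᶠ s in 𝓝 (0 : ℂ), m s = c * s * G s)
    {Φ : ℂ → ℂ} (hΦ : AnalyticAt ℂ Φ 0) {N : ℕ} (hN : 1 ≤ N)
    {Pl : ℂ[X]} (hdeg : Pl.natDegree ≤ N + 1) {r : ℂ → ℂ} (hr : AnalyticAt ℂ r 0)
    (hside : ∀ᶠ s in 𝓝[≠] (0 : ℂ), r (m s) = Φ s * (s ^ (N + 1))⁻¹ - Pl.eval (m s)⁻¹) :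
    Pl.coeff N = deriv Φ 0 * c ^ N := by
  -- the chart: analytic, `m(0) = 0`, `m′(0) = c`, `m ≠ 0` off `0`
  have hmG' : m =ᶠ[𝓝 (0 : ℂ)] fun s => c * s * G s := hmG
  have hlin : AnalyticAt ℂ (fun s : ℂ => c * s * G s) 0 :=
    (analyticAt_const.mul analyticAt_id).mul hGan
  have hman : AnalyticAt ℂ m 0 := hlin.congr hmG'.symm
  have hm0 : m 0 = 0 := by rw [hmG'.eq_of_nhds]; ring
  have hGne : ∀ᶠ s in 𝓝 (0 : ℂ), G s ≠ 0 := hGan.continuousAt.eventually_ne (by rw [hG0]; norm_num)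
  have hmne : ∀ᶠ s in 𝓝[≠] (0 : ℂ), m s ≠ 0 := by
    filter_upwards [nhdsWithin_le_nhds hmG, nhdsWithin_le_nhds hGne, self_mem_nhdsWithin]
      with s hs hG (hs0 : s ≠ 0)
    rw [hs]
    exact mul_ne_zero (mul_ne_zero hc0 hs0) hG
  have hderiv : deriv m 0 = c := by
    rw [hmG'.deriv_eq]
    have h : HasDerivAt (fun s : ℂ => c * s * G s) (c * 1 * G 0 + c * (0 : ℂ) * deriv G 0) 0 := by
      have h1 : HasDerivAt (fun s : ℂ => c * s) (c * 1) 0 := (hasDerivAt_id (0 : ℂ)).const_mul c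
      have h2 : HasDerivAt G (deriv G 0) 0 := hGan.differentiableAt.hasDerivAt
      have := h1.mul h2
      simpa [Pi.mul_def] using this
    rw [h.deriv, hG0, hG1]
    ring
  -- the top coefficient (file XIV)
  have htop : Pl.coeff (N + 1) = Φ 0 * c ^ (N + 1) := by
    rw [← hderiv]
    exact laurentPart_coeff_eq hman hm0 hmne hΦ (by omega) hdeg hr hside
  -- `m → 0` within the punctured neighbourhood
  have hmtend0 : Tendsto m (𝓝[≠] (0 : ℂ)) (𝓝 0) := by
    have h := hman.continuousAt.tendsto
    rw [hm0] at h
    exact h.mono_left nhdsWithin_le_nhds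
  have hmtend : Tendsto m (𝓝[≠] (0 : ℂ)) (𝓝[≠] 0) :=
    tendsto_nhdsWithin_iff.2 ⟨hmtend0, hmne⟩
  -- LIMIT 1: the polynomial side, along `u = m(s)`
  have hlim₁ : Tendsto (fun s => ((m s) ^ (N + 1) * Pl.eval (m s)⁻¹ - Pl.coeff (N + 1)) / m s)
      (𝓝[≠] (0 : ℂ)) (𝓝 (Pl.coeff N)) :=
    (tendsto_pow_mul_eval_inv_sub_div hdeg).comp hmtend
  -- LIMIT 2: the analytic side
  set F : ℂ → ℂ := fun s => Φ s * G s ^ (N + 1) - Φ 0 with hF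
  have hFan : AnalyticAt ℂ F 0 := (hΦ.mul (hGan.pow (N + 1))).sub analyticAt_const
  have hF0 : F 0 = 0 := by simp [hF, hG0]
  have hFd : deriv F 0 = deriv Φ 0 := by
    have h1 : HasDerivAt Φ (deriv Φ 0) 0 := hΦ.differentiableAt.hasDerivAt
    have h2 : HasDerivAt G (deriv G 0) 0 := hGan.differentiableAt.hasDerivAt
    have h3 : HasDerivAt (fun s => Φ s * G s ^ (N + 1))
        (deriv Φ 0 * G 0 ^ (N + 1) + Φ 0 * (((N + 1 : ℕ) : ℂ) * G 0 ^ (N + 1 - 1) * deriv G 0)) 0 :=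
      h1.mul (h2.pow (N + 1))
    have h4 : HasDerivAt F
        (deriv Φ 0 * G 0 ^ (N + 1) + Φ 0 * (((N + 1 : ℕ) : ℂ) * G 0 ^ (N + 1 - 1) * deriv G 0)) 0 := by
      rw [hF]
      exact h3.sub_const (Φ 0)
    rw [h4.deriv, hG0, hG1]
    simp
  have hT1 : Tendsto (fun s => F s / s) (𝓝[≠] (0 : ℂ)) (𝓝 (deriv Φ 0)) := by
    rw [← hFd]
    exact tendsto_div_of_analyticAt_zero hFan hF0
  have hT2 : Tendsto (fun s => (G s)⁻¹) (𝓝[≠] (0 : ℂ)) (𝓝 1) := by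
    have h := hGan.continuousAt.tendsto
    rw [hG0] at h
    have h' : Tendsto G (𝓝[≠] (0 : ℂ)) (𝓝 1) := h.mono_left nhdsWithin_le_nhds
    have h'' := h'.inv₀ one_ne_zero
    rwa [inv_one] at h''
  have hT3 : Tendsto (fun s => m s ^ N * r (m s)) (𝓝[≠] (0 : ℂ)) (𝓝 0) := by
    have h := (hmtend0.pow N).mul (hr.continuousAt.tendsto.comp hmtend0)
    rwa [zero_pow (by omega), zero_mul] at h
  have hlim₂ : Tendsto (fun s => c ^ N * (F s / s) * (G s)⁻¹ - m s ^ N * r (m s))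
      (𝓝[≠] (0 : ℂ)) (𝓝 (deriv Φ 0 * c ^ N)) := by
    have h := ((hT1.const_mul (c ^ N)).mul hT2).sub hT3
    rw [mul_one, sub_zero, mul_comm] at h
    exact h
  -- the two expressions agree for small `s ≠ 0`
  have heq : ∀ᶠ s in 𝓝[≠] (0 : ℂ),
      ((m s) ^ (N + 1) * Pl.eval (m s)⁻¹ - Pl.coeff (N + 1)) / m s =
        c ^ N * (F s / s) * (G s)⁻¹ - m s ^ N * r (m s) := by
    filter_upwards [hside, hmne, nhdsWithin_le_nhds hmG, nhdsWithin_le_nhds hGne,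
      self_mem_nhdsWithin] with s hs hms hmGs hGs (hs0 : s ≠ 0)
    have hPl : Pl.eval (m s)⁻¹ = Φ s * (s ^ (N + 1))⁻¹ - r (m s) := by linear_combination hs
    rw [hPl, htop, hF]
    rw [hmGs] at hms ⊢
    have hsN : s ^ (N + 1) ≠ 0 := pow_ne_zero _ hs0
    field_simp
    ring
  exact tendsto_nhds_unique (hlim₁.congr' heq) hlim₂

end Summit.Schanuel.Schanuel.Theorems

end
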